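import Summits.QuantumAdvantage.QuantumAdvantage.Theorems.PhaseDialC

/-! # PhaseDialD — part 4/6 of the landing twins of NODE «PhaseDial» (decomp-qadv lens-2 g25; node file
`g25/PhaseDial.lean`, sha256 bb3dee64cd7f1b2c…; generator `g25/tree/gen_twins.py`: namespace `Theses.PhaseDial` →
`Theorems.PhaseDial`, cut at section boundaries (node lines 872–1147), nothing else).
Content: §6 the modulus-2 layer DECIDED by transfer to `AdviceFreeQNC0.ringHardOdd_two` (`prod_affine_mem`, `table_mem_lowDeg`, `fg`, `fg_agree`, `phase_two_holds`) and §6b the cell bookkeeping (`PhaseCell`, `phaseLoss3_iff`, trivial cells `phaseCell_deg_zero / _mod_one / _deg_one`, `stabPhase_one_iff`, `phaseCell_decided`, `phaseLoss3_iff_open_cells`). -/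

set_option linter.dupNamespace false
noncomputable section
open scoped Classical

namespace Summit.QuantumAdvantage.QuantumAdvantage.Theorems.PhaseDial
open Finset
open Literature.Computability.QuantumComplexity Literature.Computability.QuantumComplexity.RingHLF
open Literature.Computability.MetaComplexity Literature.Computability.MetaComplexity.Smolensky
open Summit.QuantumAdvantage.AdviceFreeQNC0
open Summit.QuantumAdvantage.QuantumAdvantage.Theorems.AnchorDial (outB dev loss_shape_mono)
open Summit.QuantumAdvantage.QuantumAdvantage.Theorems.StabilizerDial (apIdx apStrat apStrat_mem apStrat_apply pad
  pad_mem StabFew outB_pad_pad outB_pad_congr bitP_gsum gsum gsum_mem deg_gsum dev_congr eventually_polylog winset_pad)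
open Summit.QuantumAdvantage.QuantumAdvantage.Theorems.SparsityDial (real_loss_of_frac stabFew_mono_mr one_le_logpow)
open Summit.QuantumAdvantage.QuantumAdvantage.Theorems.ResponseDial (mem_dev_apStrat dev_pad_zero
  not_polylogSparse_of_agree)
open Summit.QuantumAdvantage.QuantumAdvantage.Theorems.CounterDial (CounterForm StabCounter)
open Summit.QuantumAdvantage.QuantumAdvantage.Theorems.AbelianDial (alin TableForm StabTable AbelianLoss3
  NonAbelianLoss3 tableForm_of_counterForm stabTable_of_stabCounter nT pcell qcell pcell_injective qcell_injective
  pcell_ne_qcell qG qG_apply qStrat qStrat_agree qStrat_mem6 mem_dev_q_second indB oddZeros_indB)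
open Summit.QuantumAdvantage.QuantumAdvantage.Theorems.AbelianDial (q_in_dense_class q_not_tableForm_zero
  q_not_counterForm_zero)
open Summit.QuantumAdvantage.QuantumAdvantage.Theorems.ShadowDial (aL aW aW_pos two_mul_le_two_pow aW_mul_eight aL_lt
  aL_add_three_le acell enc dcell acell_val dcell_val acell_injective dcell_injective acell_ne_dcell dcell_ne_zero
  dcell_lt_last muxStrat muxStrat_agree muxStrat_mem_logpow mem_dev_mux_second shadow shadow_pad_zero
  q_shadow_degree_linear)
open Summit.QuantumAdvantage.QuantumAdvantage.Theorems.ScaleDial (logpow_add_logpow_le)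

variable {N : ℕ}

/-! ## §6  A DECIDED LAYER OF THE SPECIAL PIECE: modulus `2` (every `r`, every `d`) — a THEOREM by transfer

The special piece is a conjunction over phase types, `PhaseLoss3 = ∀ (m, r, d), PhaseCell m r d`.  Its MODULUS-2 LAYER
(`m + 1 = 2`: `r` PARITIES of degree-`≤ d` monomials fed to ARBITRARY tables, after a cheap gauge) is PROVED here with
constant loss (`C = 1`) and none of the density / degree / counter / table hypotheses: on odd inputs the output bit `k`
of the padded strategy equals `G_k(phases(x)) ⊕ x_k ⊕ x_{k+1}`, an `𝔽₂`-polynomial of degree `≤ r·d + 1` (Möbius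
expansion of the table, `table_mem_lowDeg`) with literally the same win set on the odd class (`winset_pad`), so
`AdviceFreeQNC0.ringHardOdd_two` applies.  The first OPEN cell is `(2, 1, 2)` ∋ `qStrat` (§3): quadratic `Z₃`-phases. -/

section ModTwo
variable {r d : ℕ}

/-- the cell of the special piece at phase type `(m, r, d)` (`PhaseLoss3 = ∀ m r d, PhaseCell m r d`, `phaseLoss3_iff`). -/
def PhaseCell (m r d : ℕ) : Prop :=
  ∃ M R : ℕ, ∃ a : ℕ, ∃ C : ℕ, ∀ c : ℕ, ∃ n₀ : ℕ, ∀ n ≥ n₀, ∀ P : Fin n → CubeFn (ZMod 3) n,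
    (∀ i, P i ∈ lowDeg (ZMod 3) n ((Nat.log 2 n) ^ c)) →
      ¬ StabFew ((Nat.log 2 n) ^ a) 0 (c + 1) P → ¬ StabCounter (c + 1) P → ¬ StabTable M R (c + 1) P →
        StabPhase m r d (c + 1) P →
          ((univ.filter fun x : Fin n → Bool =>
              OddZeros x ∧ Rel x (fun i => decide (P i x = 1))).card : ℝ)
            ≤ (1 - 1 / (n : ℝ) ^ C) * (2 : ℝ) ^ (n - 1)

/-- the special piece is the conjunction of its cells (definitional). -/
theorem phaseLoss3_iff : PhaseLoss3 ↔ ∀ m r d, PhaseCell m r d := Iff.rfl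

/-- Boolean ↦ `𝔽₂`. -/
def ι₂ (b : Bool) : ZMod 2 := if b then 1 else 0

/-- `ι₂` is additive on XOR. -/
theorem ι₂_xor (a b : Bool) : ι₂ (xor a b) = ι₂ a + ι₂ b := by
  cases a <;> cases b <;> decide

/-- a degree-`≤ d` phase over `𝔽₂` is (as a cube function) an `𝔽₂`-polynomial of degree `≤ d`. -/
theorem aphase_two_mem (w : (Fin d → Fin N) → Fin r → ZMod (1 + 1)) (j : Fin r) :
    (fun x => aphase 1 r d w x j) ∈ lowDeg (ZMod 2) N d := by
  have e : (fun x => aphase 1 r d w x j) = ∑ τ : Fin d → Fin N, w τ j • mono (ZMod 2) (univ.image τ) := by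
    funext x
    simp only [aphase, Finset.sum_apply, Pi.smul_apply, mono_apply, smul_eq_mul]
    refine Finset.sum_congr rfl fun τ _ => ?_
    have hiff : (∀ i ∈ univ.image τ, x i = true) ↔ ∀ t, x (τ t) = true := by
      constructor
      · intro h t; exact h _ (mem_image_of_mem τ (mem_univ t))
      · intro h i hi; obtain ⟨t, -, rfl⟩ := mem_image.mp hi; exact h t
    by_cases h : ∀ t, x (τ t) = true
    · rw [if_pos h, if_pos (hiff.mpr h), mul_one]
    · rw [if_neg h, if_neg (fun h' => h (hiff.mp h')), mul_zero]
  rw [e]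
  exact Submodule.sum_mem _ fun τ _ => Submodule.smul_mem _ _
    (mono_mem_lowDeg (le_trans card_image_le (by simp)))

/-- products of `lowDeg D` cube functions over a finset lie in `lowDeg (card · D)` (the folklore degree count). -/
theorem prod_mem_lowDeg₂ {F : Type*} [Field F] {ι : Type*} (s : Finset ι) {D : ℕ} (f : ι → CubeFn F N)
    (h : ∀ i ∈ s, f i ∈ lowDeg F N D) : (∏ i ∈ s, f i) ∈ lowDeg F N (s.card * D) := by
  classical
  induction s using Finset.induction_on with
  | empty =>
    rw [prod_empty, card_empty, zero_mul, ← mono_empty (F := F)]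
    exact mono_mem_lowDeg (by simp)
  | insert a s has ih =>
    rw [prod_insert has, card_insert_of_notMem has, add_mul, one_mul, add_comm]
    exact mul_mem_lowDeg_add (h a (mem_insert_self a s)) (ih fun i hi => h i (mem_insert_of_mem hi))

/-- the point indicator on `𝔽₂^r` as a product of affine factors: `Π_j (1 + z_j + u_j) = [z = u]`. -/
theorem prod_affine_eq (z u : Fin r → ZMod 2) : (∏ j, (1 + z j + u j)) = if z = u then 1 else 0 := by
  by_cases h : z = u
  · subst h
    rw [if_pos rfl]
    exact prod_eq_one fun j _ => by generalize z j = a; fin_cases a <;> decide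
  · rw [if_neg h]
    obtain ⟨j, hj⟩ : ∃ j, z j ≠ u j := by
      by_contra hc
      exact h (funext fun j => not_ne_iff.mp (not_exists.mp hc j))
    refine prod_eq_zero (mem_univ j) ?_
    generalize z j = a at hj
    generalize u j = b at hj
    fin_cases a <;> fin_cases b <;> first | exact absurd rfl hj | decide

/-- pointwise form of `prod_affine_eq` for cube functions. -/
theorem prod_affine_apply (z : Fin r → CubeFn (ZMod 2) N) (x : Fin N → Bool) (u : Fin r → ZMod 2) :
    (∏ j, (1 + z j x + u j)) = if (fun j => z j x) = u then 1 else 0 :=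
  prod_affine_eq (fun j => z j x) u

/-- MÖBIUS: an arbitrary Boolean TABLE on `𝔽₂^r` applied to `r` cube functions of degree `≤ D` is a cube function of degree
`≤ r·D` (`[G(z)] = Σ_u [G(u)] · Π_j (1 + z_j + u_j)`). -/
theorem table_mem_lowDeg (G : (Fin r → ZMod 2) → Bool) {D : ℕ} (z : Fin r → CubeFn (ZMod 2) N)
    (hz : ∀ j, z j ∈ lowDeg (ZMod 2) N D) :
    (fun x => ι₂ (G (fun j => z j x))) ∈ lowDeg (ZMod 2) N (r * D) := by
  have e : (fun x => ι₂ (G (fun j => z j x))) =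
      ∑ u : Fin r → ZMod 2, ι₂ (G u) • ∏ j : Fin r, ((1 : CubeFn (ZMod 2) N) + z j + fun _ => u j) := by
    funext x
    simp only [Finset.sum_apply, Pi.smul_apply, Finset.prod_apply, Pi.add_apply, Pi.one_apply, smul_eq_mul]
    rw [Finset.sum_eq_single (fun j => z j x)]
    · rw [prod_affine_apply, if_pos rfl, mul_one]
    · intro u _ hu
      rw [prod_affine_apply, if_neg (Ne.symm hu), mul_zero]
    · intro hu; exact absurd (mem_univ _) hu
  rw [e]
  refine Submodule.sum_mem _ fun u _ => Submodule.smul_mem _ _ ?_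
  have h1 : (1 : CubeFn (ZMod 2) N) ∈ lowDeg (ZMod 2) N D := by
    rw [← mono_empty (F := ZMod 2)]; exact mono_mem_lowDeg (by simp)
  have hu : ∀ j, (fun _ : Fin N → Bool => u j) ∈ lowDeg (ZMod 2) N D := fun j => by
    have e1 : (fun _ : Fin N → Bool => u j) = u j • (1 : CubeFn (ZMod 2) N) := by funext x; simp
    rw [e1]; exact Submodule.smul_mem _ _ h1
  have h := prod_mem_lowDeg₂ (univ : Finset (Fin r)) (fun j => (1 : CubeFn (ZMod 2) N) + z j + fun _ => u j)
    (fun j _ => Submodule.add_mem _ (Submodule.add_mem _ h1 (hz j)) (hu j))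
  rw [card_univ, Fintype.card_fin] at h
  exact h

/-- under phase form `(1, r, d)`: the would-be output bit `G_k(phases(x)) ⊕ t_k(x)` as an `𝔽₂` cube function … -/
def f2 (w : Fin N → (Fin d → Fin N) → Fin r → ZMod (1 + 1)) (G : Fin N → (Fin r → ZMod (1 + 1)) → Bool) (k : Fin N) :
    CubeFn (ZMod 2) N :=
  fun x => ι₂ (xor (G k (aphase 1 r d (w k) x)) (tGuess x k))

/-- … has `𝔽₂`-degree `≤ r·d + 1` … -/
theorem f2_mem (w : Fin N → (Fin d → Fin N) → Fin r → ZMod (1 + 1)) (G : Fin N → (Fin r → ZMod (1 + 1)) → Bool)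
    (k : Fin N) : f2 w G k ∈ lowDeg (ZMod 2) N (r * d + 1) := by
  have e : f2 w G k = (fun x => ι₂ (G k (fun j => (fun y => aphase 1 r d (w k) y j) x))) +
      (mono (ZMod 2) {k} + mono (ZMod 2) {nxt k}) := by
    funext x
    simp only [f2, Pi.add_apply, mono_apply, mem_singleton, forall_eq]
    unfold tGuess
    rw [ι₂_xor, ι₂_xor]
    rfl
  rw [e]
  exact Submodule.add_mem _ (lowDeg_mono (Nat.le_succ _) (table_mem_lowDeg (G k) _ fun j => aphase_two_mem (w k) j))
    (lowDeg_mono (show 1 ≤ r * d + 1 by omega)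
      (Submodule.add_mem _ (mono_mem_lowDeg (by simp)) (mono_mem_lowDeg (by simp))))

/-- … and AGREES with the true output bit on every ODD input. -/
theorem f2_agree {w : Fin N → (Fin d → Fin N) → Fin r → ZMod (1 + 1)} {G : Fin N → (Fin r → ZMod (1 + 1)) → Bool}
    {Q : Fin N → CubeFn (ZMod 3) N} (hF : PhaseForm 1 r d w G Q) (x : Fin N → Bool) (hx : OddZeros x) (k : Fin N) :
    decide (f2 w G k x = 1) = decide (Q k x = 1) := by
  have h := hF x hx k
  simp only [Summit.QuantumAdvantage.QuantumAdvantage.Theorems.AnchorDial.dev, mem_filter, mem_univ, true_and] at h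
  unfold f2 ι₂
  revert h
  generalize G k (aphase 1 r d (w k) x) = g
  generalize tGuess x k = t
  generalize decide (Q k x = 1) = q
  cases g <;> cases t <;> cases q <;> decide

/-- ★★★ **THE MODULUS-2 LAYER IS A THEOREM**: cheaply `(1, r, d)`-phase-form strategies lose a constant fraction of the
odd class (`C = 1`), for every `r, d` and every gauge exponent — no density, degree, counter or table hypothesis. -/
theorem phase_two_holds (r d : ℕ) : ∃ C : ℕ, ∀ e : ℕ, ∃ n₀ : ℕ, ∀ n ≥ n₀, ∀ P : Fin n → CubeFn (ZMod 3) n,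
    StabPhase 1 r d e P →
      ((univ.filter fun x : Fin n → Bool => OddZeros x ∧ Rel x (fun i => decide (P i x = 1))).card : ℝ)
        ≤ (1 - 1 / (n : ℝ) ^ C) * (2 : ℝ) ^ (n - 1) := by
  obtain ⟨θ, hθ, hall⟩ := ringHardOdd_two
  obtain ⟨M, hM⟩ := exists_nat_ge (1 / (1 - θ))
  refine ⟨1, fun e => ?_⟩
  obtain ⟨n₀, hn₀⟩ := hall 1
  refine ⟨max n₀ (max M (2 ^ (r * d + 1))), fun n hn P hst => ?_⟩
  have hn₀' : n₀ ≤ n := le_trans (le_max_left _ _) hn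
  have hM' : M ≤ n := le_trans (le_trans (le_max_left _ _) (le_max_right _ _)) hn
  have h2 : 2 ^ (r * d + 1) ≤ n := le_trans (le_trans (le_max_right _ _) (le_max_right _ _)) hn
  have hn1 : 1 ≤ n := le_trans Nat.one_le_two_pow h2
  have hlog : r * d + 1 ≤ (Nat.log 2 n) ^ 1 := by
    rw [pow_one]; exact Nat.le_log_of_pow_le (by norm_num) h2
  obtain ⟨s, -, w, G, hF⟩ := hst
  have h := hn₀ n hn₀' (fun k => f2 w G k) (fun k => lowDeg_mono hlog (f2_mem w G k))
  have hset : (univ.filter fun x : Fin n → Bool => OddZeros x ∧ Rel x (fun i => decide (f2 w G i x = 1)))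
      = univ.filter fun x : Fin n → Bool => OddZeros x ∧ Rel x (fun i => decide (P i x = 1)) := by
    rw [← winset_pad P s]
    refine Finset.filter_congr fun x _ => and_congr_right fun hx => ?_
    rw [show (fun i => decide (f2 w G i x = 1)) = (fun i => decide (pad P s i x = 1)) from
      funext fun i => f2_agree hF x hx i]
  rw [hset] at h
  have hθn : θ ≤ 1 - 1 / (n : ℝ) ^ 1 := by
    rw [pow_one]
    have h1θ : 0 < 1 - θ := by linarith
    have hnpos : (0 : ℝ) < n := by exact_mod_cast (show 0 < n by omega)
    have hMr : 1 / (1 - θ) ≤ (n : ℝ) := le_trans hM (by exact_mod_cast hM')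
    rw [div_le_iff₀ h1θ] at hMr
    have h3 : 1 / (n : ℝ) ≤ 1 - θ := by
      rw [div_le_iff₀ hnpos]; linarith
    linarith
  exact le_trans h (mul_le_mul_of_nonneg_right hθn (by positivity))

/-- ★ hence EVERY MODULUS-2 CELL of the special piece holds (abelian type and exponents arbitrary, the class hypotheses
unused): a decided, non-vacuous layer of `PhaseLoss3`.  The first open cell is `(2, 1, 2)` ∋ `qStrat`. -/
theorem phaseCell_mod_two (r d : ℕ) : PhaseCell 1 r d := by
  obtain ⟨C, hC⟩ := phase_two_holds r d
  refine ⟨0, 0, 0, C, fun c => ?_⟩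
  obtain ⟨n₀, h⟩ := hC (c + 1)
  exact ⟨n₀, fun n hn P _ _ _ _ hφ => h n hn P hφ⟩

end ModTwo

/-! ### the cell map: trivial cells (`d ≤ 1` or modulus `1`), the decided layer (modulus `2`), the open cells

By design the special piece only bites BEYOND the abelian dial: a cell whose phase form is already a table form is
excluded by its own hypothesis `¬ StabTable M R` for the right `(M, R)`, hence TRIVIALLY true — this is the case for
degree `d = 0` and modulus `m + 1 = 1` (constant readouts: table form of type `(0, 0)`) and for degree `d = 1` (phase form
`(m, r, 1)` IS table form `(m, r)`, `tableForm_of_phaseForm_one`).  Non-trivial cells: `d ≥ 2` and `m ≥ 1`; of these the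
modulus-`2` layer is DECIDED (`phaseCell_mod_two`), and the cells `m ≥ 2, d ≥ 2` are OPEN — first `(2, 1, 2)` ∋ `qStrat`. -/

section Cells
variable {m r d e : ℕ} {P : Fin N → CubeFn (ZMod 3) N}

/-- a phase form whose readout does not depend on the input is a table form of type `(0, 0)` (constant gates). -/
theorem stabTable_of_stabPhase_const (h : StabPhase m r d e P)
    (hc : ∀ (w : (Fin d → Fin N) → Fin r → ZMod (m + 1)) (x y : Fin N → Bool), aphase m r d w x = aphase m r d w y) :
    StabTable 0 0 e P := by
  obtain ⟨s, hs, w, G, hF⟩ := h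
  refine ⟨s, hs, fun _ _ _ => 0, fun k _ => G k (aphase m r d (w k) (fun _ => true)), fun x hx k => ?_⟩
  rw [hF x hx k, hc (w k) x (fun _ => true)]

/-- degree `0`: the readout is constant. -/
theorem aphase_deg_zero (w : (Fin 0 → Fin N) → Fin r → ZMod (m + 1)) (x y : Fin N → Bool) :
    aphase m r 0 w x = aphase m r 0 w y := by
  funext j
  unfold aphase
  exact Finset.sum_congr rfl fun τ _ => by rw [if_pos (fun t => t.elim0), if_pos (fun t => t.elim0)]

/-- modulus `1`: the readout is constant (`Z_1` is a point). -/
theorem aphase_mod_one (w : (Fin d → Fin N) → Fin r → ZMod (0 + 1)) (x y : Fin N → Bool) :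
    aphase 0 r d w x = aphase 0 r d w y := by
  have h1 : ∀ a b : ZMod (0 + 1), a = b := by decide
  funext j; exact h1 _ _

/-- a cell whose readout is always constant holds trivially (type `(M, R) := (0, 0)`). -/
theorem phaseCell_of_const
    (hc : ∀ (N : ℕ) (w : (Fin d → Fin N) → Fin r → ZMod (m + 1)) (x y : Fin N → Bool),
      aphase m r d w x = aphase m r d w y) : PhaseCell m r d :=
  ⟨0, 0, 0, 0, fun _ => ⟨0, fun n _ _ _ _ _ hT hφ => absurd (stabTable_of_stabPhase_const hφ (hc n)) hT⟩⟩

/-- the degree-`0` cells hold trivially … -/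
theorem phaseCell_deg_zero (m r : ℕ) : PhaseCell m r 0 := phaseCell_of_const fun _ w x y => aphase_deg_zero w x y

/-- … as do the modulus-`1` cells. -/
theorem phaseCell_mod_one (r d : ℕ) : PhaseCell 0 r d := phaseCell_of_const fun _ w x y => aphase_mod_one w x y

/-- degree `1`: phase form `(m, r, 1)` IS table form `(m, r)` (converse of `phaseForm_of_tableForm`). -/
theorem tableForm_of_phaseForm_one {w : Fin N → (Fin 1 → Fin N) → Fin r → ZMod (m + 1)}
    {G : Fin N → (Fin r → ZMod (m + 1)) → Bool} {Q : Fin N → CubeFn (ZMod 3) N} (h : PhaseForm m r 1 w G Q) :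
    TableForm m r (fun k i => w k (fun _ => i)) G Q := fun x hx k => by
  have e : (fun τ : Fin 1 → Fin N => w k (fun _ => τ 0)) = w k :=
    funext fun τ => congrArg (w k) (funext fun t => by rw [Subsingleton.elim t 0])
  have h2 : alin m r (fun i => w k (fun _ => i)) x = aphase m r 1 (w k) x := by
    rw [← aphase_one]; exact congrArg (fun v => aphase m r 1 v x) e
  show k ∈ dev Q x ↔ G k (alin m r (fun i => w k (fun _ => i)) x) = true
  rw [h2]; exact h x hx k

/-- cheaply `(m, r, 1)`-phase-form ⟺ cheaply `(m, r)`-table-form: the degree-one layer of the phase dial IS the abelian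
dial. -/
theorem stabPhase_one_iff : StabPhase m r 1 e P ↔ StabTable m r e P :=
  ⟨fun ⟨s, hs, _, _, hF⟩ => ⟨s, hs, _, _, tableForm_of_phaseForm_one hF⟩, stabPhase_of_stabTable⟩

/-- hence the degree-`1` cells hold trivially (type `(M, R) := (m, r)`): the abelian content lives in the SIBLING piece
`AbelianLoss3` of NODE «AbelianDial», not in `PhaseLoss3`. -/
theorem phaseCell_deg_one (m r : ℕ) : PhaseCell m r 1 :=
  ⟨m, r, 0, 0, fun _ => ⟨0, fun _ _ _ _ _ _ hT hφ => absurd (stabPhase_one_iff.mp hφ) hT⟩⟩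

/-- ★ **THE CELL MAP** (summary): every cell with `d ≤ 1`, or `m = 0`, or `m = 1` holds — trivially resp. by the
modulus-2 theorem; the open cells are `m ≥ 2 ∧ d ≥ 2`. -/
theorem phaseCell_decided (m r d : ℕ) (h : d ≤ 1 ∨ m ≤ 1) : PhaseCell m r d := by
  rcases h with h | h
  · interval_cases d
    · exact phaseCell_deg_zero m r
    · exact phaseCell_deg_one m r
  · interval_cases m
    · exact phaseCell_mod_one r d
    · exact phaseCell_mod_two r d

/-- so the special piece REDUCES to its open cells: `PhaseLoss3 ⟺ ∀ m ≥ 2, ∀ r, ∀ d ≥ 2, PhaseCell m r d`. -/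
theorem phaseLoss3_iff_open_cells : PhaseLoss3 ↔ ∀ m r d : ℕ, 2 ≤ m → 2 ≤ d → PhaseCell m r d := by
  rw [phaseLoss3_iff]
  refine ⟨fun h m r d _ _ => h m r d, fun h m r d => ?_⟩
  by_cases hm : 2 ≤ m
  · by_cases hd : 2 ≤ d
    · exact h m r d hm hd
    · exact phaseCell_decided m r d (Or.inl (by omega))
  · exact phaseCell_decided m r d (Or.inr (by omega))

end Cells

end Summit.QuantumAdvantage.QuantumAdvantage.Theorems.PhaseDial
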